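import Literature.MathematicalPhysics.QuantumLattice.VacuumConnectedCoeffBound
import Literature.MathematicalPhysics.QuantumLattice.HubbardTruncatedCoeffThermodynamicLimit
import Literature.Analysis.Complex.ExpRecursionPowerSeries
import HarnessLib

/-!
# Finite-temperature perturbation theory of the 2D Hubbard torus pressure converges uniformly in the volume

The single-scale theorem for the grand-canonical Hubbard model `H = dΓ(h_L) + U Σ_x n_{x↑}n_{x↓}` on the
discrete torus `(ℤ/Lℤ)²` (`hubbardTorusWith 2 L 1 U μ`, one-body operator
`h_L = hubbardOneBody (fermionTorusGraph 2 L) 1 μ`): for every inverse temperature `β ≥ 0` and chemical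
potential `μ` there is a radius `R = R(β, μ) > 0`, INDEPENDENT OF THE VOLUME, such that for all `L ≥ 3`
and all complex `|U| < R` the Dyson series of the partition function resums as

`Σ_m U^m b_m(L) = Z_L(0) · exp (Σ_{j ≥ 1} c_j(L) U^j)`,  `|c_j(L)| ≤ L² · A · ϱ^j`  (`A, ϱ` independent of `L`),

where `b_m(L) = hubbardVacuumCoeff` (so that `Σ_m U^m b_m(L) = Tr e^{-β(H_L(U) - μN)}` for real `U`,
`hasSum_hubbardVacuumCoeff`) and `c_j(L)` are the connected coefficients of `VacuumLinkedCluster`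
(truncated expectations of the vacuum word, written out with `ursellOf`, `FermionicTree.moment`,
`vacuumCluster`, `vacuumPropMatrix`, `orderedIntegral`). Consequently, for real `|U| < R`, the
finite-volume pressure `β⁻¹L⁻² log Z_L(U)` differs from the free one by the convergent power series
`β⁻¹L⁻² Σ_j c_j(L) U^j`, analytic in `U` and bounded uniformly in `L` — the elementary ("single-scale")
domain of analyticity `|U| ≲ T·(Σ_z |g_β(z)|)⁻¹` of Benfatto–Giuliani–Mastropietro 2006 (the bound
(2.77) before the multiscale analysis), which the renormalisation group of that paper extends to
`|U| log β ≤ const`.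

Ingredients: the determinant bound `2` of de Siqueira Pedra–Salmhofer for the chronological free
propagator (`PropMatrixTruncatedBound`), the Brydges–Battle–Federbush tree expansion under a determinant
bound and its positional sum (`FermionicTreeExpansionDetBound(Decay)`), the uniform torus-distance decay
of the free thermal propagator (`HubbardFreePropagatorTorusDecay`, through
`exists_norm_hubbardThermalTwoPointEvolved_le_tnZ`), the linked-cluster recursion
(`VacuumLinkedCluster`), the coefficient bound (`VacuumConnectedCoeffBound`) and the exponential
relation `Z = Z(0) e^C` (`Literature.Analysis.Complex.ExpRecursionPowerSeries`).

* `Torus.tnorm_neg`, `Torus.proj_sub`, `sum_inv_one_add_tnorm_pow_le_tsum` (with the tree's `Torus.proj_cRep`) — torus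
  geometry: the decay weight summed over the torus is bounded by its sum over `ℤ²`;
* `vacuumPropMatrix_torus_apply`, `norm_vacuumPropMatrix_torus_apply_le` — the entries of the vacuum
  propagator matrix at projected integer positions are evolved free two-point functions, uniformly
  small in the torus distance;
* `hubbardTorus_vacuumLineBound` — the line-bound hypothesis of `norm_vacuumConnectedCoeff_le` for `h_L`;
* `norm_hubbardTorus_connectedCoeff_le` — `‖c_j(L)‖ ≤ L² · β^j/j! · j^{j-2} · 4^j · (8 C S)^{j-1}`;
* **`hubbardTorus_partitionFn_eq_exp_connected`** — the displayed resummation with volume-independent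
  radius and bounds.

Everything is PROVED; no definition and no named fact.

## References
* G. Benfatto, A. Giuliani, V. Mastropietro, Ann. Henri Poincaré 7 (2006) 809–898, §2 (2.77).
  [cite: BenfattoGiulianiMastropietro2006, (2.77)]
* W. de Siqueira Pedra, M. Salmhofer, Comm. Math. Phys. 282 (2008) 797–818, Thm 2.4. [cite: PedraSalmhofer2008, Thm 2.4]
* D. C. Brydges, Les Houches 1984, §2. [cite: Brydges1986, §2]
-/

noncomputable section

open scoped Matrix.Norms.L2Operator ComplexOrder
open Finset MeasureTheory Set NormedSpace
open Literature.Probability.LatticeModels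
open Literature.Probability.LatticeModels.BattleFederbush

namespace Literature.MathematicalPhysics.QuantumLattice

/-! ### Torus geometry -/

section TorusGeometry

variable {d L : ℕ} [NeZero L]

/-- The torus norm is even. [folklore] -/
theorem Torus.tnorm_neg (u : TorusSite d L) : Torus.tnorm (-u) = Torus.tnorm u :=
  le_antisymm (Torus.tnorm_neg_le u) (by simpa using Torus.tnorm_neg_le (-u))

omit [NeZero L] in
/-- The projection to the torus is additive. [folklore] -/
theorem Torus.proj_sub (x y : Site d) : Torus.proj L (x - y) = Torus.proj L x - Torus.proj L y := by
  funext i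
  simp [Torus.proj]

/-- **The decay weight summed over the torus is bounded by its sum over `ℤ²`, uniformly in `L`**
(the centred lift is injective and `tnorm u = ‖cRep u‖_∞`). [folklore] -/
theorem sum_inv_one_add_tnorm_pow_le_tsum {K : ℕ} (hK : 4 ≤ K) :
    ∑ u : TorusSite 2 L, ((1 + (Torus.tnorm u : ℝ)) ^ K)⁻¹ ≤ ∑' z : Site 2, ((1 + ‖z‖) ^ K)⁻¹ := by
  have hsum : Summable fun z : Site 2 => ((1 + ‖z‖) ^ K)⁻¹ := summable_inv_one_add_norm_pow (by omega)
  have hinj : Function.Injective (Torus.cRep (d := 2) (L := L)) := Torus.cRep_injective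
  calc ∑ u : TorusSite 2 L, ((1 + (Torus.tnorm u : ℝ)) ^ K)⁻¹
      = ∑ z ∈ (univ : Finset (TorusSite 2 L)).image Torus.cRep, ((1 + ‖z‖) ^ K)⁻¹ := by
        rw [Finset.sum_image fun u _ v _ h => hinj h]
        refine Finset.sum_congr rfl fun u _ => ?_
        rw [Site.norm_eq_supNorm]
        rfl
    _ ≤ ∑' z : Site 2, ((1 + ‖z‖) ^ K)⁻¹ :=
        hsum.sum_le_tsum _ fun z _ => by positivity

end TorusGeometry

/-! ### The vacuum word on the torus: entries and their decay -/

section Entries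

variable (β μ : ℝ) {L : ℕ} [NeZero L]

/-- **The entries of the vacuum propagator matrix at projected integer positions are evolved free
two-point functions**: for the torus one-body operator `h_L`, vertices `proj ∘ Z` and complex vertex
times `τ`, entry `(p, q)` is `⟨a⁺_{Z_{v(p)} s(p)}(τ_{v(p)}) a⁻_{Z_{v(q)} s(q)}(τ_{v(q)})⟩_{β,L,0}` for
`p ≤ q` and minus the same at the time `τ_{v(q)} - β` for `p > q` (`v(p) = ⌊p/2⌋`, `s(p) = p mod 2`).
[cite: BenfattoGiulianiMastropietro2006, §2.1 (2.6)] -/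
theorem vacuumPropMatrix_torus_apply {j : ℕ} (Z : Fin j → Site 2) (τ : Fin j → ℂ) (p q : Fin (j * 2)) :
    vacuumPropMatrix β (hubbardOneBody (fermionTorusGraph 2 L) 1 μ)
        (fun i => FermionTorus.ofTorusSite (Torus.proj L (Z i))) τ p q =
      if p ≤ q then
        hubbardThermalTwoPointEvolved β 0 μ L (Z (finProdFinEquiv.symm p).1) (finProdFinEquiv.symm p).2
          (τ (finProdFinEquiv.symm p).1) (Z (finProdFinEquiv.symm q).1) (finProdFinEquiv.symm q).2
          (τ (finProdFinEquiv.symm q).1)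
      else
        -hubbardThermalTwoPointEvolved β 0 μ L (Z (finProdFinEquiv.symm p).1) (finProdFinEquiv.symm p).2
          (τ (finProdFinEquiv.symm p).1) (Z (finProdFinEquiv.symm q).1) (finProdFinEquiv.symm q).2
          (τ (finProdFinEquiv.symm q).1 - β) := by
  unfold vacuumPropMatrix propMatrix
  rw [Matrix.of_apply]
  by_cases hpq : p ≤ q
  · rw [if_pos hpq, if_pos hpq]
    -- instance paths on `Orb (FermionTorus 2 L)` differ between the files: `convert`
    convert fermi_evolve_apply_eq_hubbardThermalTwoPointEvolved (L := L) β μ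
      (Z (finProdFinEquiv.symm p).1) (Z (finProdFinEquiv.symm q).1)
      (finProdFinEquiv.symm p).2 (finProdFinEquiv.symm q).2
      (τ (finProdFinEquiv.symm p).1) (τ (finProdFinEquiv.symm q).1) using 8
  · rw [if_neg hpq, if_neg hpq]
    refine congrArg Neg.neg ?_
    convert fermi_evolve_neg_apply_eq_hubbardThermalTwoPointEvolved (L := L) β μ
      (Z (finProdFinEquiv.symm p).1) (Z (finProdFinEquiv.symm q).1)
      (finProdFinEquiv.symm p).2 (finProdFinEquiv.symm q).2
      (τ (finProdFinEquiv.symm p).1) (τ (finProdFinEquiv.symm q).1) using 8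

/-- **The entries of the vacuum propagator matrix are uniformly small in the torus distance of the
vertices**: with `C, K` as in `exists_norm_hubbardThermalTwoPointEvolved_le_tnZ` for the separations
`[-2β, β]`, simplex times `v ∈ [0,1]^j` (vertex times `-βv_i ∈ [-β, 0]`) and `L ≥ 3`,
`|G'(p, q)| ≤ C (1 + tnZ_L(Z_{v(q)} - Z_{v(p)}))^{-K}`. [cite: BenfattoGiulianiMastropietro2006, §2.2] -/
theorem norm_vacuumPropMatrix_torus_apply_le (hβ : 0 ≤ β) {K : ℕ} {C : ℝ}
    (hC : ∀ (L : ℕ), 3 ≤ L → ∀ (t s : ℝ), s - t ∈ Icc (-(2 * β)) β →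
      ∀ (x₁ y₁ : Site 2) (σ₁ σ₂ : Fin 2),
        ‖hubbardThermalTwoPointEvolved β 0 μ L x₁ σ₁ (t : ℂ) y₁ σ₂ (s : ℂ)‖ ≤
          C * ((1 + (tnZ L (y₁ - x₁) : ℝ)) ^ K)⁻¹)
    (hL : 3 ≤ L) {j : ℕ} (Z : Fin j → Site 2) {v : Fin j → ℝ} (hv : ∀ i, v i ∈ Icc (0 : ℝ) 1)
    (p q : Fin (j * 2)) :
    ‖vacuumPropMatrix β (hubbardOneBody (fermionTorusGraph 2 L) 1 μ)
        (fun i => FermionTorus.ofTorusSite (Torus.proj L (Z i))) (fun i => ((v i : ℝ) : ℂ) * -(β : ℂ)) p q‖ ≤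
      C * ((1 + (tnZ L (Z (finProdFinEquiv.symm q).1 - Z (finProdFinEquiv.symm p).1) : ℝ)) ^ K)⁻¹ := by
  have htime : ∀ i, ((v i : ℝ) : ℂ) * -(β : ℂ) = (((-β * v i : ℝ)) : ℂ) := fun i => by push_cast; ring
  have hmem : ∀ i, -β * v i ∈ Icc (-β) 0 := fun i => by
    constructor <;> nlinarith [(hv i).1, (hv i).2]
  rw [vacuumPropMatrix_torus_apply]
  have ha := hmem (finProdFinEquiv.symm p).1
  have hb := hmem (finProdFinEquiv.symm q).1
  split_ifs with hpq
  · rw [htime, htime]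
    exact hC L hL _ _ ⟨by linarith [ha.1, ha.2, hb.1, hb.2], by linarith [ha.1, ha.2, hb.1, hb.2]⟩ _ _ _ _
  · rw [norm_neg, htime, htime,
      show (((-β * v (finProdFinEquiv.symm q).1 : ℝ)) : ℂ) - (β : ℂ) =
        (((-β * v (finProdFinEquiv.symm q).1 - β : ℝ)) : ℂ) by push_cast; ring]
    exact hC L hL _ _ ⟨by linarith [ha.1, ha.2, hb.1, hb.2], by linarith [ha.1, ha.2, hb.1, hb.2]⟩ _ _ _ _

/-- **The line-bound hypothesis of `norm_vacuumConnectedCoeff_le` for the Hubbard torus**: with the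
decay data `C, K` of the free thermal propagator, for every `L ≥ 3`, simplex times, vertex sites `g`
(identified with torus points by `toTorusSite`) and pairs `f, f'`,
`|G'_L(f, f')| ≤ γ_L(u_f - u_{f'})`, `γ_L(u) = C (1 + tnorm u)^{-K}`. [cite: BenfattoGiulianiMastropietro2006, §2.2] -/
theorem hubbardTorus_vacuumLineBound (hβ : 0 ≤ β) {K : ℕ} {C : ℝ}
    (hC : ∀ (L : ℕ), 3 ≤ L → ∀ (t s : ℝ), s - t ∈ Icc (-(2 * β)) β →
      ∀ (x₁ y₁ : Site 2) (σ₁ σ₂ : Fin 2),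
        ‖hubbardThermalTwoPointEvolved β 0 μ L x₁ σ₁ (t : ℂ) y₁ σ₂ (s : ℂ)‖ ≤
          C * ((1 + (tnZ L (y₁ - x₁) : ℝ)) ^ K)⁻¹)
    (hL : 3 ≤ L) {j : ℕ} (v : Fin j → ℝ) (hv : ∀ i, v i ∈ Icc (0 : ℝ) 1)
    (g : Fin j → FermionTorus 2 L) (f f' : Fin (j * 2)) :
    ‖vacuumPropMatrix β (hubbardOneBody (fermionTorusGraph 2 L) 1 μ) g
        (fun i => ((v i : ℝ) : ℂ) * -(β : ℂ)) f f'‖ ≤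
      C * ((1 + (Torus.tnorm (FermionTorus.toTorusSite (g (vacuumCluster j f)) -
        FermionTorus.toTorusSite (g (vacuumCluster j f'))) : ℝ)) ^ K)⁻¹ := by
  -- write the sites as projected centred representatives
  set Z : Fin j → Site 2 := fun i => Torus.cRep (FermionTorus.toTorusSite (g i)) with hZ
  have hg : g = fun i => FermionTorus.ofTorusSite (Torus.proj L (Z i)) := by
    funext i
    simp only [hZ, Torus.proj_cRep, FermionTorus.ofTorusSite_toTorusSite]
  rw [hg]
  refine (norm_vacuumPropMatrix_torus_apply_le β μ hβ hC hL Z hv f f').trans (le_of_eq ?_)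
  simp only [tnZ, Torus.proj_sub, FermionTorus.toTorusSite_ofTorusSite, vacuumCluster]
  rw [← Torus.tnorm_neg, neg_sub]

end Entries

/-! ### The connected coefficients of the torus pressure -/

section Coefficients

variable (β μ : ℝ)

/-- **The single-scale bound on the connected coefficients of the Hubbard torus pressure, uniformly in
the volume**: with the decay data `C, K ≥ 4` of the free thermal propagator (separations `[-2β, β]`) and
`S = Σ_{z ∈ ℤ²} (1 + ‖z‖)^{-K}`, for all `L ≥ 3` and `j ≥ 1`,
`‖c_j(L)‖ ≤ L² · β^j/j! · j^{j-2} · 4^j · (8 C S)^{j-1}`. [cite: BenfattoGiulianiMastropietro2006, (2.77)] -/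
theorem norm_hubbardTorus_connectedCoeff_le (hβ : 0 ≤ β) {K : ℕ} (hK : 4 ≤ K) {C : ℝ} (hC0 : 0 ≤ C)
    (hC : ∀ (L : ℕ), 3 ≤ L → ∀ (t s : ℝ), s - t ∈ Icc (-(2 * β)) β →
      ∀ (x₁ y₁ : Site 2) (σ₁ σ₂ : Fin 2),
        ‖hubbardThermalTwoPointEvolved β 0 μ L x₁ σ₁ (t : ℂ) y₁ σ₂ (s : ℂ)‖ ≤
          C * ((1 + (tnZ L (y₁ - x₁) : ℝ)) ^ K)⁻¹)
    {L : ℕ} (hL : 3 ≤ L) {j : ℕ} (hj : 1 ≤ j) :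
    ‖orderedIntegral j (fun v : Fin j → ℝ => (-(β : ℂ)) ^ j * ∑ g : Fin j → FermionTorus 2 L,
        ursellOf (FermionicTree.moment (vacuumCluster j)
          (vacuumPropMatrix β (hubbardOneBody (fermionTorusGraph 2 L) 1 μ) g
            (fun i => ((v i : ℝ) : ℂ) * -(β : ℂ)))) univ) 1‖ ≤
      (L : ℝ) ^ 2 * (β ^ j / j.factorial) *
        ((j : ℝ) ^ (j - 2) * ((2 : ℝ) ^ (j * 2) * (8 * (C * ∑' z : Site 2, ((1 + ‖z‖) ^ K)⁻¹)) ^ (j - 1))) := by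
  haveI : NeZero L := ⟨by omega⟩
  set S : ℝ := ∑' z : Site 2, ((1 + ‖z‖) ^ K)⁻¹ with hS
  have hS0 : 0 ≤ S := tsum_nonneg fun z => by positivity
  -- sites ↔ torus points
  set pos : FermionTorus 2 L ≃ TorusSite 2 L :=
    ⟨FermionTorus.toTorusSite, FermionTorus.ofTorusSite, FermionTorus.ofTorusSite_toTorusSite,
      FermionTorus.toTorusSite_ofTorusSite⟩ with hpos
  set γ : TorusSite 2 L → ℝ := fun u => C * ((1 + (Torus.tnorm u : ℝ)) ^ K)⁻¹ with hγ
  have hγ0 : ∀ u, 0 ≤ γ u := fun u => by positivity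
  have hγeven : ∀ u, γ (-u) = γ u := fun u => by simp only [hγ, Torus.tnorm_neg]
  have key := norm_vacuumConnectedCoeff_le β (hubbardOneBody (fermionTorusGraph 2 L) 1 μ)
    (isHermitian_hubbardOneBody (fermionTorusGraph 2 L) 1 μ) hβ pos γ hγ0 hγeven hj
    (fun v hvm hv01 g f f' => hubbardTorus_vacuumLineBound β μ hβ hC hL v hv01 g f f')
  refine key.trans ?_
  -- `|TorusSite 2 L| = L²` and `Σ_u γ u ≤ C S`
  have hcard : (Fintype.card (TorusSite 2 L) : ℝ) = (L : ℝ) ^ 2 := by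
    rw [show Fintype.card (TorusSite 2 L) = L ^ 2 by
      simp only [TorusSite, Fintype.card_pi, ZMod.card, Finset.prod_const, Finset.card_univ,
        Fintype.card_fin]]
    push_cast
    ring
  have hsumγ : ∑ u, γ u ≤ C * S := by
    simp only [hγ]
    rw [← Finset.mul_sum]
    exact mul_le_mul_of_nonneg_left (sum_inv_one_add_tnorm_pow_le_tsum hK) hC0
  have hsumγ0 : 0 ≤ ∑ u, γ u := sum_nonneg fun u _ => hγ0 u
  rw [hcard]
  gcongr

/-- Unfolding the vacuum coefficient of `HubbardLinkedCluster`. [folklore] -/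
theorem hubbardVacuumCoeff_eq_orderedIntegral {Λ : Type*} [LinearOrder Λ] [Fintype Λ] (G : SimpleGraph Λ)
    [DecidableRel G.Adj] (t : ℝ) (m : ℕ) :
    hubbardVacuumCoeff G β t μ m = orderedIntegral m (vacuumIntegrand β (hubbardOneBody G t μ)
      (Matrix.partitionFn β (dGamma (hubbardOneBody G t μ))) m) 1 := rfl

/-- The order-zero vacuum coefficient is the free partition function. [folklore] -/
theorem hubbardVacuumCoeff_zero {Λ : Type*} [LinearOrder Λ] [Fintype Λ] (G : SimpleGraph Λ)
    [DecidableRel G.Adj] (t : ℝ) :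
    hubbardVacuumCoeff G β t μ 0 = Matrix.partitionFn β (dGamma (hubbardOneBody G t μ)) := by
  unfold hubbardVacuumCoeff vacuumIntegrand
  rw [orderedIntegral_zero, pow_zero, one_mul, Fintype.sum_unique]
  haveI : IsEmpty (Fin (0 * 2)) := by rw [Nat.zero_mul]; infer_instance
  rw [Matrix.det_isEmpty, mul_one]

/-- **Finite-temperature perturbation theory of the 2D Hubbard torus converges uniformly in the
volume.** For every `β ≥ 0` and `μ` there are `R > 0` and `A ≥ 0` such that for all `L ≥ 3`:
(i) the connected coefficients obey `‖c_j(L)‖ ≤ L² · A · R^{-j}` for `j ≥ 1`, and (ii) for every complex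
`|U| < R` the Dyson series of the partition function of `hubbardTorusWith 2 L 1 U μ` resums to
`Z_L(0) · exp (Σ_{j ≥ 1} c_j(L) U^j)` — so `log Z_L(U) - log Z_L(0) = Σ_j c_j(L) U^j` is analytic in
`|U| < R` and `O(L²)` there, uniformly in `L` (Benfatto–Giuliani–Mastropietro 2006, the single-scale
bound (2.77); the determinant bound of de Siqueira Pedra–Salmhofer 2008). [cite: BenfattoGiulianiMastropietro2006, (2.77)] -/
theorem hubbardTorus_partitionFn_eq_exp_connected (hβ : 0 ≤ β) :
    ∃ R : ℝ, 0 < R ∧ ∃ A : ℝ, 0 ≤ A ∧ ∀ (L : ℕ), 3 ≤ L →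
      (∀ j : ℕ, 1 ≤ j →
        ‖orderedIntegral j (fun v : Fin j → ℝ => (-(β : ℂ)) ^ j * ∑ g : Fin j → FermionTorus 2 L,
            ursellOf (FermionicTree.moment (vacuumCluster j)
              (vacuumPropMatrix β (hubbardOneBody (fermionTorusGraph 2 L) 1 μ) g
                (fun i => ((v i : ℝ) : ℂ) * -(β : ℂ)))) univ) 1‖ ≤ (L : ℝ) ^ 2 * A * R⁻¹ ^ j) ∧
      ∀ U : ℂ, ‖U‖ < R →
        HasSum (fun m : ℕ => U ^ m * hubbardVacuumCoeff (fermionTorusGraph 2 L) β 1 μ m)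
          (Matrix.partitionFn β (dGamma (hubbardOneBody (fermionTorusGraph 2 L) 1 μ)) *
            Complex.exp (∑' j : ℕ, (if j = 0 then 0 else
              orderedIntegral j (fun v : Fin j → ℝ => (-(β : ℂ)) ^ j * ∑ g : Fin j → FermionTorus 2 L,
                ursellOf (FermionicTree.moment (vacuumCluster j)
                  (vacuumPropMatrix β (hubbardOneBody (fermionTorusGraph 2 L) 1 μ) g
                    (fun i => ((v i : ℝ) : ℂ) * -(β : ℂ)))) univ) 1) * U ^ j)) := by
  classical
  -- decay data for the separations `[-2β, β]`, `K = 4`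
  obtain ⟨C, hCpos, hC⟩ := exists_norm_hubbardThermalTwoPointEvolved_le_tnZ β μ (-(2 * β)) β
    (K := 4) le_rfl
  set S : ℝ := ∑' z : Site 2, ((1 + ‖z‖) ^ 4)⁻¹ with hS
  have hS0 : 0 ≤ S := tsum_nonneg fun z => by positivity
  have hSpos : 0 < S := by
    have hsum : Summable fun z : Site 2 => ((1 + ‖z‖) ^ 4)⁻¹ := summable_inv_one_add_norm_pow (by norm_num)
    exact hsum.tsum_pos (fun z => by positivity) 0 (by norm_num)
  -- the constants
  set ϱ : ℝ := 32 * Real.exp 1 * β * (C * S) + 1 with hϱ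
  have hϱ1 : 1 ≤ ϱ := by
    have : 0 ≤ 32 * Real.exp 1 * β * (C * S) := by positivity
    linarith
  have hϱpos : 0 < ϱ := by linarith
  refine ⟨ϱ⁻¹, by positivity, (8 * (C * S))⁻¹ + 1, by positivity, fun L hL => ?_⟩
  haveI : NeZero L := ⟨by omega⟩
  -- (i) the geometric bound on the connected coefficients
  have hcoef : ∀ j : ℕ, 1 ≤ j →
      ‖orderedIntegral j (fun v : Fin j → ℝ => (-(β : ℂ)) ^ j * ∑ g : Fin j → FermionTorus 2 L,
          ursellOf (FermionicTree.moment (vacuumCluster j)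
            (vacuumPropMatrix β (hubbardOneBody (fermionTorusGraph 2 L) 1 μ) g
              (fun i => ((v i : ℝ) : ℂ) * -(β : ℂ)))) univ) 1‖ ≤
        (L : ℝ) ^ 2 * ((8 * (C * S))⁻¹ + 1) * ϱ⁻¹⁻¹ ^ j := by
    intro j hj
    rw [inv_inv]
    refine (norm_hubbardTorus_connectedCoeff_le β μ hβ le_rfl hCpos.le hC hL hj).trans ?_
    have hL2 : (0 : ℝ) ≤ (L : ℝ) ^ 2 := by positivity
    rw [mul_assoc, mul_assoc]
    refine mul_le_mul_of_nonneg_left ?_ hL2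
    -- goal: `β^j/j! · j^{j-2} · 4^j · (8CS)^{j-1} ≤ ((8CS)⁻¹ + 1) · ϱ^j`
    have hjR : (1 : ℝ) ≤ j := by exact_mod_cast hj
    have hfact : (j : ℝ) ^ (j - 2) / j.factorial ≤ Real.exp 1 ^ j := by
      calc (j : ℝ) ^ (j - 2) / j.factorial ≤ (j : ℝ) ^ j / j.factorial :=
            div_le_div_of_nonneg_right (pow_le_pow_right₀ hjR (Nat.sub_le j 2)) (by positivity)
        _ ≤ Real.exp j := Real.pow_div_factorial_le_exp (x := (j : ℝ)) (by positivity) j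
        _ = Real.exp 1 ^ j := by rw [← Real.exp_nat_mul, mul_one]
    have h4 : (2 : ℝ) ^ (j * 2) = 4 ^ j := by rw [mul_comm, pow_mul]; norm_num
    have hCSpos : 0 < C * S := mul_pos hCpos hSpos
    have hne : (8 * (C * S)) ≠ 0 := by positivity
    have h8 : (8 * (C * S)) ^ (j - 1) = (8 * (C * S)) ^ j * (8 * (C * S))⁻¹ := by
      rw [eq_mul_inv_iff_mul_eq₀ hne, ← pow_succ, Nat.sub_add_cancel hj]
    calc β ^ j / j.factorial * ((j : ℝ) ^ (j - 2) * ((2 : ℝ) ^ (j * 2) * (8 * (C * S)) ^ (j - 1)))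
        = ((j : ℝ) ^ (j - 2) / j.factorial) * (β ^ j * (4 ^ j * (8 * (C * S)) ^ j)) * (8 * (C * S))⁻¹ := by
          rw [h4, h8]; ring
      _ ≤ Real.exp 1 ^ j * (β ^ j * (4 ^ j * (8 * (C * S)) ^ j)) * (8 * (C * S))⁻¹ := by
          gcongr
      _ = (8 * (C * S))⁻¹ * (32 * Real.exp 1 * β * (C * S)) ^ j := by
          have h32 : (32 : ℝ) ^ j = 4 ^ j * 8 ^ j := by rw [← mul_pow]; norm_num
          simp only [mul_pow]
          rw [h32]
          ring
      _ ≤ ((8 * (C * S))⁻¹ + 1) * ϱ ^ j := by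
          gcongr
          · linarith [inv_nonneg.mpr (by positivity : (0 : ℝ) ≤ 8 * (C * S))]
          · rw [hϱ]; linarith
  refine ⟨hcoef, fun U hU => ?_⟩
  -- (ii) the exponential resummation: `b_m = hubbardVacuumCoeff`, `c_j` the connected coefficient
  have hbsum : ∀ r : ℝ, 0 ≤ r → r < ϱ⁻¹ →
      Summable fun k => ‖hubbardVacuumCoeff (fermionTorusGraph 2 L) β 1 μ k‖ * r ^ k := by
    intro r hr _
    refine (summable_norm_hubbardVacuumCoeff (fermionTorusGraph 2 L) β 1 r μ).congr fun k => ?_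
    rw [norm_mul, norm_pow, Complex.norm_real, Real.norm_of_nonneg hr, mul_comm]
  have hcsum : ∀ r : ℝ, 0 ≤ r → r < ϱ⁻¹ → Summable fun j : ℕ =>
      ‖(if j = 0 then 0 else
        orderedIntegral j (fun v : Fin j → ℝ => (-(β : ℂ)) ^ j * ∑ g : Fin j → FermionTorus 2 L,
          ursellOf (FermionicTree.moment (vacuumCluster j)
            (vacuumPropMatrix β (hubbardOneBody (fermionTorusGraph 2 L) 1 μ) g
              (fun i => ((v i : ℝ) : ℂ) * -(β : ℂ)))) univ) 1)‖ * r ^ j := by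
    intro r hr hrR
    have hq : r * ϱ < 1 := by
      have := mul_lt_mul_of_pos_right hrR hϱpos
      rwa [inv_mul_cancel₀ hϱpos.ne'] at this
    have hgeo : Summable fun j : ℕ => (L : ℝ) ^ 2 * ((8 * (C * S))⁻¹ + 1) * (r * ϱ) ^ j :=
      (summable_geometric_of_lt_one (by positivity) hq).mul_left _
    refine Summable.of_nonneg_of_le (fun j => by positivity) (fun j => ?_) hgeo
    by_cases hj0 : j = 0
    · subst hj0
      simp only [if_true, norm_zero, pow_zero, mul_one]
      positivity
    · have hj : 1 ≤ j := Nat.one_le_iff_ne_zero.mpr hj0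
      have hcj := hcoef j hj
      rw [inv_inv] at hcj
      rw [if_neg hj0]
      calc _ ≤ (L : ℝ) ^ 2 * ((8 * (C * S))⁻¹ + 1) * ϱ ^ j * r ^ j :=
            mul_le_mul_of_nonneg_right hcj (pow_nonneg hr _)
        _ = (L : ℝ) ^ 2 * ((8 * (C * S))⁻¹ + 1) * (r * ϱ) ^ j := by rw [mul_pow]; ring
  have hc0 : ((if (0:ℕ) = 0 then 0 else
        orderedIntegral 0 (fun v : Fin 0 → ℝ => (-(β : ℂ)) ^ 0 * ∑ g : Fin 0 → FermionTorus 2 L,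
          ursellOf (FermionicTree.moment (vacuumCluster 0)
            (vacuumPropMatrix β (hubbardOneBody (fermionTorusGraph 2 L) 1 μ) g
              (fun i => ((v i : ℝ) : ℂ) * -(β : ℂ)))) univ) 1) : ℂ) = 0 := if_pos rfl
  -- the recursion `k b_k = Σ j c_j b_{k-j}` (`VacuumLinkedCluster`)
  have hrec : ∀ k : ℕ, (k : ℂ) * hubbardVacuumCoeff (fermionTorusGraph 2 L) β 1 μ k =
      ∑ p ∈ antidiagonal k, (p.1 : ℂ) * (if p.1 = 0 then 0 else
        orderedIntegral p.1 (fun v : Fin p.1 → ℝ => (-(β : ℂ)) ^ p.1 * ∑ g : Fin p.1 → FermionTorus 2 L,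
          ursellOf (FermionicTree.moment (vacuumCluster p.1)
            (vacuumPropMatrix β (hubbardOneBody (fermionTorusGraph 2 L) 1 μ) g
              (fun i => ((v i : ℝ) : ℂ) * -(β : ℂ)))) univ) 1) * hubbardVacuumCoeff (fermionTorusGraph 2 L) β 1 μ p.2 := by
    intro k
    rw [hubbardVacuumCoeff_eq_orderedIntegral, vacuum_linkedCluster_recursion]
    refine Finset.sum_congr rfl fun p _ => ?_
    rw [hubbardVacuumCoeff_eq_orderedIntegral]
    by_cases hp : p.1 = 0
    · simp only [hp, Nat.cast_zero, zero_mul]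
    · rw [if_neg hp]
  -- `Z = Z(0) e^C` on `|U| < ϱ⁻¹`
  have key := Literature.Analysis.Complex.tsum_eq_mul_exp_tsum_of_recursion hbsum hcsum hc0 hrec hU
  rw [hubbardVacuumCoeff_zero] at key
  have hsU : Summable fun k => hubbardVacuumCoeff (fermionTorusGraph 2 L) β 1 μ k * U ^ k := by
    refine Summable.of_norm ?_
    refine (hbsum ‖U‖ (norm_nonneg U) hU).congr fun k => ?_
    rw [norm_mul, norm_pow]
  have hfun : (fun m : ℕ => U ^ m * hubbardVacuumCoeff (fermionTorusGraph 2 L) β 1 μ m) =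
      fun m => hubbardVacuumCoeff (fermionTorusGraph 2 L) β 1 μ m * U ^ m :=
    funext fun m => mul_comm _ _
  have h2 := hsU.hasSum
  rw [key] at h2
  rw [hfun]
  convert h2 using 3

end Coefficients

end Literature.MathematicalPhysics.QuantumLattice
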